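import Mathlib.RingTheory.Localization.BaseChange
import Mathlib.RingTheory.Localization.Module
import Summits.BirchSwinnertonDyer.BirchSwinnertonDyer.Theorems.SignedLowerHalvesSmallImageLowerHalfBothSignsRttE2NumLambdaCount
import HarnessLib

/-!
# Route `SignedLowerHalves`, crux L `SmallImageLowerHalfBothSigns` (item stmt-BirchSwinnertonDyer-23599), line `rtt_w3` — row E2-num, part 6:
# the GENERAL `ℤ_p ↔ 𝒪` λ-bridge `dim_{ℚ_p}(ℚ_p ⊗_{ℤ_p} M) = [E:ℚ_p] · dim_E(E ⊗_{𝒪_E} M)` for EVERY `𝒪_E`-module `M` (any `μ`)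

Width seat `bsd-line-slh-p3-w3` g19 under LEAD `cruxlead-stmt-BirchSwinnertonDyer-23599` g9 (cell `bsd-ssimc`); ROUTE-INDEPENDENT helper
(`--supports stmt-BirchSwinnertonDyer-23599`); THEOREMS ONLY — no definition, no named fact, no instance, no `sorry`; pure commutative algebra;
closes nothing; BSD is not proved by any of this. Removes caveat §3(1) of `Lines/rtt_w3-MEMO-w3-g19.md` (part 2, p774419, proved the bridge only for
`M` finitely generated over `𝒪_E`, i.e. `μ = 0`).

WHY. The E2-tail and the LEAD's §3 algebra (p773570) live in the tree's `lambdaInvariant p = dim_{ℚ_p}(ℚ_p ⊗_{ℤ_p} ·)`; road D / road T deliver the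
global input (K) `λ(𝐇¹/Λ_𝒪 z) ≤ λ(𝐇²)` from an equality of CHARACTERISTIC IDEALS over `Λ_𝒪 = 𝒪⟦T⟧`, read in `dim_E(E ⊗_𝒪 ·)` by RTT@2's H-λchar
(`…CharIdealLambda.finrank_baseChange_eq_of_span_C_mul_charIdeal_eq`), for modules whose `μ` need not vanish. The conversion between the two
currencies is this file's single theorem, with NO finiteness or torsion hypothesis: both sides are the localisation of `M` at the powers of `p`.

* ★★ **`finrank_padic_baseChange_eq_mul`** — `𝒪 = PadicIntermediateField.unitBall p E` (`E/ℚ_p` finite; `= padicCoeffIntegers S` by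
  `padicCoeffIntegers_eq_unitBall`), `M` any `𝒪`-module with its restricted `ℤ_p`-structure (`[Module ℤ_[p] M] [IsScalarTower ℤ_[p] 𝒪 M]`):
  `Module.finrank ℚ_[p] (ℚ_[p] ⊗[ℤ_[p]] M) = Module.finrank ℚ_[p] E * Module.finrank E (E ⊗[𝒪] M)`.
  PROOF: `m ↦ 1 ⊗ m : M → E ⊗_𝒪 M` is a localisation of the `ℤ_p`-module `M` at `ℤ_p ∖ 0` (`IsLocalizedModule`: every non-zero `p`-adic integer acts
  invertibly; every `e ∈ E` is `x/pⁿ` with `x ∈ 𝒪`; `1 ⊗ m = 0` iff `c·m = 0` for some `c ∈ 𝒪 ∖ 0` (`E = Frac 𝒪`), and `c ∣ p^N`), as is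
  `ℚ_p ⊗_{ℤ_p} M` (Mathlib); two localisations are isomorphic (`IsLocalizedModule.linearEquiv`), `ℚ_p`-linearly
  (`LinearEquiv.extendScalarsOfIsLocalization`); then the tower law `dim_{ℚ_p} = [E:ℚ_p]·dim_E`.
* For the tree's `lambdaInvariant p M` on the left (a `Λ`-module `M` whose `ℤ_p`-structure satisfies `(C r)•m = r•m`) compose with part 5's adapter
  `lambdaInvariant_eq_finrank_baseChange_of_C_smul` (`…RttE2NumHeadline`).

References: [Washington1997] §13.2; [BourbakiAC5to7] II §2 (localisation of modules).
-/

set_option autoImplicit false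
-- the Theorems namespace of this sub repeats the summit name by design (D-0017 nested layout)
set_option linter.dupNamespace false

noncomputable section

open scoped TensorProduct

open Literature.NumberTheory.Automorphic

namespace Summit.BirchSwinnertonDyer.BirchSwinnertonDyer.Theorems.SmallImageRttE2Num

universe w

variable (p : ℕ) [Fact p.Prime] (E : IntermediateField ℚ_[p] (PadicAlgCl p)) [FiniteDimensional ℚ_[p] E]

omit [FiniteDimensional ℚ_[p] E] in
/-- Every `e ∈ E` is `x / pⁿ` with `x ∈ 𝒪_E`: `pⁿ • e = x` for `n` large (`‖p‖ < 1`). [folklore] -/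
theorem exists_pow_smul_eq_algebraMap (e : E) :
    ∃ (n : ℕ) (x : PadicIntermediateField.unitBall p E),
      ((p : ℤ_[p]) ^ n) • e = algebraMap (PadicIntermediateField.unitBall p E) E x := by
  have hp1 : ‖((p : ℕ) : PadicAlgCl p)‖ < 1 := by
    rw [show ((p : ℕ) : PadicAlgCl p) = algebraMap ℚ_[p] (PadicAlgCl p) (p : ℚ_[p]) by simp, PadicAlgCl.norm_extends]
    exact Padic.norm_p_lt_one
  by_cases he : (e : PadicAlgCl p) = 0
  · refine ⟨0, 0, ?_⟩
    have : e = 0 := by exact_mod_cast he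
    rw [this, smul_zero, map_zero]
  · have hepos : 0 < ‖(e : PadicAlgCl p)‖⁻¹ := inv_pos.mpr (norm_pos_iff.mpr he)
    obtain ⟨n, hn⟩ := exists_pow_lt_of_lt_one hepos hp1
    have hle : ‖((p : ℕ) : PadicAlgCl p) ^ n * (e : PadicAlgCl p)‖ ≤ 1 := by
      rw [norm_mul, norm_pow]
      have := mul_lt_mul_of_pos_right hn (norm_pos_iff.mpr he)
      rw [inv_mul_cancel₀ (norm_ne_zero_iff.mpr he)] at this
      exact this.le
    have hmem : ((p : ℕ) : PadicAlgCl p) ^ n * (e : PadicAlgCl p) ∈ PadicIntermediateField.unitBall p E := by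
      rw [PadicIntermediateField.mem_unitBall_iff]
      refine ⟨mul_mem (pow_mem (by exact_mod_cast natCast_mem E p) n) e.2, ?_⟩
      rw [PadicAlgCl.valuation_def]
      exact_mod_cast hle
    refine ⟨n, ⟨_, hmem⟩, ?_⟩
    apply Subtype.ext
    rw [PadicIntermediateField.coe_algebraMap_unitBall]
    change ((((p : ℤ_[p]) ^ n) • e : E) : PadicAlgCl p) = ((p : ℕ) : PadicAlgCl p) ^ n * (e : PadicAlgCl p)
    rw [Algebra.smul_def, map_pow, map_natCast]
    push_cast
    rfl

set_option maxHeartbeats 400000 in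
/-- ★★ **The general `ℤ_p ↔ 𝒪` λ-bridge.** For `𝒪 = 𝒪_E` (`E/ℚ_p` finite) and ANY `𝒪`-module `M` with its restricted `ℤ_p`-structure:
`dim_{ℚ_p}(ℚ_p ⊗_{ℤ_p} M) = [E:ℚ_p] · dim_E(E ⊗_𝒪 M)` — both tensor products are the localisation of `M` at the powers of `p`, and `dim_{ℚ_p} = [E:ℚ_p]·dim_E`
on `E`-vector spaces. No finiteness, no torsion hypothesis (for `μ > 0` Iwasawa modules both sides see only the `p`-torsion-free part). [cite: Washington1997, §13.2]
[cite: BourbakiAC5to7, II §2] -/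
theorem finrank_padic_baseChange_eq_mul (M : Type w) [AddCommGroup M] [Module (PadicIntermediateField.unitBall p E) M] [Module ℤ_[p] M]
    [IsScalarTower ℤ_[p] (PadicIntermediateField.unitBall p E) M] :
    Module.finrank ℚ_[p] (ℚ_[p] ⊗[ℤ_[p]] M) =
      Module.finrank ℚ_[p] E * Module.finrank E (E ⊗[PadicIntermediateField.unitBall p E] M) := by
  haveI : IsFractionRing (PadicIntermediateField.unitBall p E) E := IsIntegralClosure.isFractionRing_of_finite_extension ℤ_[p] ℚ_[p] E (PadicIntermediateField.unitBall p E)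
  -- `m ↦ 1 ⊗ m` as a `ℤ_p`-linear map into the `ℚ_p`-vector space `E ⊗_𝒪 M`
  let g : M →ₗ[ℤ_[p]] E ⊗[(PadicIntermediateField.unitBall p E)] M := ((TensorProduct.mk (PadicIntermediateField.unitBall p E) E M) 1).restrictScalars ℤ_[p]
  have hg_apply : ∀ m : M, g m = (1 : E) ⊗ₜ[(PadicIntermediateField.unitBall p E)] m := fun _ ↦ rfl
  -- it is a localisation at `ℤ_p ∖ 0`
  haveI hloc : IsLocalizedModule (nonZeroDivisors ℤ_[p]) g := by
    refine ⟨fun s ↦ ?_, fun y ↦ ?_, fun {m₁ m₂} h ↦ ?_⟩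
    · -- non-zero `p`-adic integers act invertibly on the `E`-vector space `E ⊗ M`
      have hs0 : algebraMap ℤ_[p] E (s : ℤ_[p]) ≠ 0 := by
        rw [ne_eq, map_eq_zero_iff _ (FaithfulSMul.algebraMap_injective ℤ_[p] E)]
        exact nonZeroDivisors.coe_ne_zero s
      rw [Module.End.isUnit_iff]
      have heq : ∀ x : E ⊗[(PadicIntermediateField.unitBall p E)] M, (algebraMap ℤ_[p] (Module.End ℤ_[p] (E ⊗[(PadicIntermediateField.unitBall p E)] M)) (s : ℤ_[p])) x =
          (algebraMap ℤ_[p] E (s : ℤ_[p])) • x := fun x ↦ by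
        rw [Module.algebraMap_end_apply, algebraMap_smul]
      constructor
      · intro x y hxy
        have := congrArg (fun z ↦ (algebraMap ℤ_[p] E (s : ℤ_[p]))⁻¹ • z) hxy
        simpa only [heq, smul_smul, inv_mul_cancel₀ hs0, one_smul] using this
      · intro y
        refine ⟨(algebraMap ℤ_[p] E (s : ℤ_[p]))⁻¹ • y, ?_⟩
        rw [heq, smul_smul, mul_inv_cancel₀ hs0, one_smul]
    · -- every element is `(1 ⊗ m) / p^n`
      induction y using TensorProduct.induction_on with
      | zero => exact ⟨(0, 1), by simp⟩
      | tmul e m =>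
        obtain ⟨n, x, hx⟩ := exists_pow_smul_eq_algebraMap p E e
        refine ⟨(x • m, ⟨(p : ℤ_[p]) ^ n, pow_mem (mem_nonZeroDivisors_of_ne_zero
          (Nat.cast_ne_zero.mpr (Fact.out : p.Prime).ne_zero)) n⟩), ?_⟩
        change ((p : ℤ_[p]) ^ n) • (e ⊗ₜ[(PadicIntermediateField.unitBall p E)] m) = g (x • m)
        rw [hg_apply, TensorProduct.smul_tmul', hx, Algebra.algebraMap_eq_smul_one, TensorProduct.smul_tmul]
      | add y₁ y₂ h₁ h₂ =>
        obtain ⟨⟨m₁, s₁⟩, h₁⟩ := h₁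
        obtain ⟨⟨m₂, s₂⟩, h₂⟩ := h₂
        refine ⟨((s₂ : ℤ_[p]) • m₁ + (s₁ : ℤ_[p]) • m₂, s₁ * s₂), ?_⟩
        change ((s₁ : ℤ_[p]) * s₂) • (y₁ + y₂) = g ((s₂ : ℤ_[p]) • m₁ + (s₁ : ℤ_[p]) • m₂)
        rw [map_add, map_smul, map_smul, ← h₁, ← h₂, smul_add, mul_smul, mul_smul, smul_comm (s₁ : ℤ_[p]) (s₂ : ℤ_[p]) y₁]
        rfl
    · -- `1 ⊗ m₁ = 1 ⊗ m₂` ⇒ `c • m₁ = c • m₂` for some `c ∈ 𝒪 ∖ 0`, and `c ∣ p^N`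
      have h' : (TensorProduct.mk (PadicIntermediateField.unitBall p E) E M 1) m₁ = (TensorProduct.mk (PadicIntermediateField.unitBall p E) E M 1) m₂ := h
      obtain ⟨c, hc⟩ := IsLocalizedModule.exists_of_eq (S := nonZeroDivisors (PadicIntermediateField.unitBall p E)) (f := TensorProduct.mk (PadicIntermediateField.unitBall p E) E M 1) h'
      obtain ⟨N, d, hd⟩ := exists_dvd_natCast_prime_pow p E (nonZeroDivisors.coe_ne_zero c)
      refine ⟨⟨(p : ℤ_[p]) ^ N, pow_mem (mem_nonZeroDivisors_of_ne_zero
        (Nat.cast_ne_zero.mpr (Fact.out : p.Prime).ne_zero)) N⟩, ?_⟩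
      change ((p : ℤ_[p]) ^ N) • m₁ = ((p : ℤ_[p]) ^ N) • m₂
      have hc' : (c : (PadicIntermediateField.unitBall p E)) • m₁ = (c : (PadicIntermediateField.unitBall p E)) • m₂ := hc
      rw [← IsScalarTower.algebraMap_smul (PadicIntermediateField.unitBall p E) ((p : ℤ_[p]) ^ N) m₁, ← IsScalarTower.algebraMap_smul (PadicIntermediateField.unitBall p E) ((p : ℤ_[p]) ^ N) m₂,
        map_pow, map_natCast, hd, mul_comm, mul_smul, mul_smul, hc']
  -- two localisations of `M` at `ℤ_p ∖ 0` are isomorphic, `ℚ_p`-linearly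
  let e₀ : (ℚ_[p] ⊗[ℤ_[p]] M) ≃ₗ[ℤ_[p]] (E ⊗[(PadicIntermediateField.unitBall p E)] M) :=
    IsLocalizedModule.linearEquiv (nonZeroDivisors ℤ_[p]) ((TensorProduct.mk ℤ_[p] ℚ_[p] M) 1) g
  let e : (ℚ_[p] ⊗[ℤ_[p]] M) ≃ₗ[ℚ_[p]] (E ⊗[(PadicIntermediateField.unitBall p E)] M) := e₀.extendScalarsOfIsLocalization (nonZeroDivisors ℤ_[p]) ℚ_[p]
  rw [e.finrank_eq, ← Module.finrank_mul_finrank ℚ_[p] E (E ⊗[(PadicIntermediateField.unitBall p E)] M)]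

end Summit.BirchSwinnertonDyer.BirchSwinnertonDyer.Theorems.SmallImageRttE2Num

end
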